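/-
Copyright (c) 2026 the pub-hodgecm-mathlib formalisation cell (harness21).  Prover seat hodgecm-mathlib-K2Liu-p09 (g9), Track B «K2-LIT» ∕ hLiu418
#184♮, #42S BLOCK D row D-2, (σ-A) brick (an-3c) §3b piece (B) = (B1) «the graph reading, operator layer» + (B2-read) (road desk K2Liu-p25 (g3)
WORDS #51, #53; consumer K2Liu-p08 (g6) piece (A), coordinate sequel (B2-coord) K2Liu-p12 (g6)), 2026-09-05.  THEOREMS ONLY.
-/
import Summits.HodgeConjecture.HodgeConjecture.Theorems.K2LiuLocalSWCornerImplementerLetters   -- ★ p864771 (b′): `hB` ∃-letters at `frameMp_{PD} j̃(p₁,p₂)` (+ ★ p864614, ★ (C2c), ★ (C2b′))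
import Summits.HodgeConjecture.HodgeConjecture.Theorems.K2LiuLocalSWCornerActionWordsZeta       -- ★ p864336 [A1-ζ]: the Levi word through any implementer
import HarnessLib

/-!
# Crux `HLiu418`, #42S block D row D-2, (σ-A) brick (an-3c) §3b (B1): THE GRAPH READING, OPERATOR LAYER — the conjugate
# `op(j̃) ∘ frameOp_{PD}⁻¹ ∘ ω(s′(p₀ ⊗ 1)) ∘ frameOp_{PD} ∘ op(j̃)⁻¹` of a small Siegel-Levi element IS `c · |det B|^{-1/2} · Ψ(PD⁻¹ B⁻¹ PD ·)`,
# `B` the ∃-discharged Levi letter; and (B2-read): how `B` is READ on vectors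

Cell `hodgecm-mathlib`, crux item hLiu418 = `stmt-HodgeConjecture-24832`; squad K2 ∕ K2Liu; helper lane `--supports stmt-HodgeConjecture-24832 --as helper`,
count-neutral.  THEOREMS ONLY (no `def`, no `instance`, no `notation`, no named-fact hypothesis, no `sorry`).

WHY.  K2Liu-p08 (g6)'s (an-3c) §3b telescope feeds ★ p864878 `conePackage_of_stageLetters`'s slot `hL2 : N₁ x ζ = cF · ∫_s V_x (Z_s ζ ⊔ s) dσ`.  After ★ [A1]
p864240 ∕ p864439 the integrand at the point `x₁ ⊔ 0` carries the operator `op(j̃)(frameOp_{PD}⁻¹(ω(s′((p(ζ) · g′) ⊗ 1)) Φ))`, `p(ζ) = m₁ · φ(w₁′) · φ(u⁻(ζ))` the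
ζ-stage corner prefix (a Siegel-LEVI element of the small doubled group) — and `s′` is a homomorphism, so with `Ψ := op(j̃)(frameOp⁻¹(ω(s′(g′ ⊗ 1)) Φ))` one must read
the conjugate `T_{p₀} := op(j̃) ∘ frameOp⁻¹ ∘ ω(s′(p₀ ⊗ 1)) ∘ frameOp ∘ op(j̃)⁻¹` on `𝒮(L⁺_v^{n′})`, `n′ = (M₂+M₂)+(M₂+M₂)`.  THIS FILE (piece (B1), desk WORD #53):
* §0 `levi_mul_blocks` — products of Siegel-Levi elements are Siegel-Levi with multiplicative `A`- and `D`-blocks (★ `adapt_mul`);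
  **`mulVec_eq_fst_apply_of_eq_transportSp_levi`** ∕ `inv_mulVec_eq_fst_apply_of_eq_transportSp_levi` = (B2-read): if `g = transportSp 𝕋 (m(B))` then
  `B x = (g (x, 0)).1`, `(g (x, 0)).2 = 0`, `B⁻¹ x = (g⁻¹ (x, 0)).1` — the Levi letter READ ON VECTORS (the input of K2Liu-p12's (B2-coord) point computation);
* §1 **`exists_levi_letter_toOp_boxLoc_localSplitting_tensorEmbLoc_apply`** — for every small Siegel-Levi `p₀` (`B(p₀) = 0 = C(p₀)`): `∃ B` with ★ [A1-ζ]'s `hB`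
  bytes at `m := frameMp_{PD} j̃(p₁, p₂)` (★ p864771) AND, for every `Ψ`, `u`:
  `(T_{p₀} Ψ)(u) = (χ_v⁻¹(det_Δ p₀)^{M₂})⁻¹ · |det B|^{-1/2} · Ψ(PDfr⁻¹ (B⁻¹ (PDfr u)))`, `PDfr = frameLin PD` (`x ↦ P̂D x`) —
  ★ (C2b′) `toOp_boxLoc_frameOp_symm` (`op(j̃) ∘ frameOp⁻¹ = frameOp⁻¹ ∘ op(frameMp j̃)`), ★ [A1-ζ] `toOp_localOmega_tensorEmbLoc_eq_smul_leviOpPi`,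
  ★ `coe_frameOp_symm_apply`, ★ `coe_leviOpPi_apply`, ★ `coe_frameOp_apply`; coordinate-free, for ANY Cayley-lettered block movers `(p₁, p₂)`;
SEQUEL (`K2LiuConeGraphReadingCornerPrefix`, same seat): §1 at the ζ-stage corner prefix `p(z) = (w₁ · φ(w₂)) · φ(w₁′) · φ(u⁻(z))` (Siegel-Levi by ★ [A1-mat] ∕
★ p864439 (Y1) ∕ ★ B1b-2d and §0) with its Siegel character value rewritten `z`-FREE (`χ_v(det_Δ p(z)) = χ_v(det_Δ((w₁ · φ(w₂)) · φ(w₁′)))`).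
(B2-coord) (K2Liu-p12 (g6)) then computes `PDfr⁻¹ (B⁻¹ (PDfr (x₁ ⊔ 0))) = Z_{x₁} ζ′ ⊔ λ·x₁` and `|det B| = const` at the EXPLICIT Cayley pair.
HONEST LABEL.  Count-neutral helper: `HC_CM` is proved only modulo the 7 printed citations (2 remaining named inputs: hLiu418 = `stmt-HodgeConjecture-24832`,
h413 = `stmt-HodgeConjecture-24833`) until rung 0 closes.

## References
* [Kudla1994] S. S. Kudla, Israel J. Math. 87 (1994), §3, Thm. 3.1.   * [Rangarao1993] R. Ranga Rao, Pacific J. Math. 157 (1993), Lemma 3.2 (3.8), p. 351.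
* [MoeglinVignerasWaldspurger1987] LNM 1291 (1987), Chap. 2 I.7, II.1 Rem. (3), (6), II.2, II.6.   * [HarrisKudlaSweet1996] J. AMS 9 (1996), §1 (1.11)–(1.12), (1.15)–(1.16).
* [Weil1964] A. Weil, Acta Math. 111 (1964), n° 6, 13, 34.
-/

set_option autoImplicit false
-- the mandated namespace repeats the single-problem summit's segment (`HodgeConjecture.HodgeConjecture`)
set_option linter.dupNamespace false

noncomputable section

open scoped Matrix Kronecker
open NumberField IsDedekindDomain MeasureTheory Matrix
open Literature.RepresentationTheory.HeisenbergGroup Literature.RepresentationTheory.HeisenbergGroup.SymplecticMatrix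
open Literature.NumberTheory.Automorphic Literature.NumberTheory.Automorphic.UnitaryGroup Literature.NumberTheory.Weil1964
open Literature.NumberTheory.GaloisRepresentations Literature.NumberTheory.GaloisRepresentations.IsNonarchimedeanLocalField
open Literature.RepresentationTheory.HarrisKudlaSweet1996
open Literature.NumberTheory.GelbartRogawski1991 Literature.NumberTheory.GelbartRogawski1991.GRConstruction
open Literature.NumberTheory.GelbartRogawski1991.AdaptedBlocks
open Literature.NumberTheory.GelbartRogawski1991.UnitaryDualPair
open Literature.NumberTheory.GelbartRogawski1991.UnitaryDualPair.LocalSplitting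
open Literature.NumberTheory.GelbartRogawski1991.UnitaryDualPair.LocalSplitting.FrameTransport
open Literature.NumberTheory.GelbartRogawski1991.UnitaryDualPair.LocalSplitting.DoubledBlock
open Literature.NumberTheory.K2Lit.SiegelDoubled Literature.NumberTheory.K2Lit.LocalSiegelDoubled
open Summit.HodgeConjecture.HodgeConjecture.Cruxes.HLiu418.K2LiuLocalSWSectionDefs
open Summit.HodgeConjecture.HodgeConjecture.Cruxes.HLiu418.K2LiuLocalSWTensorAdaptedBlocks
open Summit.HodgeConjecture.HodgeConjecture.Cruxes.HLiu418.K2LiuLocalSiegelIwasawa (antidiagonal_over_eq_map)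
open Summit.HodgeConjecture.HodgeConjecture.Cruxes.HLiu418.K2LiuDoubledUTwoTwoBorelFrame (uMinus)
open Summit.HodgeConjecture.HodgeConjecture.Cruxes.HLiu418.K2LiuDoubledUTwoTwoWeylCocycle (weylOne weylTwo)
open Summit.HodgeConjecture.HodgeConjecture.Cruxes.HLiu418.K2LiuDoubledUTwoTwoFrameTransport (toLocalFour)
open Summit.HodgeConjecture.HodgeConjecture.Cruxes.HLiu418.K2LiuDoubledUTwoTwoLetterTransport (blocks_matA_frameConj_weylOne blocks_matA_frameConj_uMinus)
open Summit.HodgeConjecture.HodgeConjecture.Cruxes.HLiu418.K2LiuLocalFourCornerFactorisation (isSiegelDelta_flip_mul_frameConj_weylTwo)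
open Summit.HodgeConjecture.HodgeConjecture.Cruxes.HLiu418.K2LiuLocalSWCornerActionWordsYStage (fromBlocks_one_sub_single_one blkC_matA_flip_mul_frameConj_weylTwo)
open Summit.HodgeConjecture.HodgeConjecture.Cruxes.HLiu418.K2LiuSiegelLeviWeylAlgebra (detDelta_levi)
open Summit.HodgeConjecture.HodgeConjecture.Cruxes.HLiu418.K2LiuTensorMiddleCellHaarDelta (toOp_boxLoc_frameOp_symm)
open Summit.HodgeConjecture.HodgeConjecture.Cruxes.HLiu418.K2LiuLocalSWCornerActionWordsZeta (toOp_localOmega_tensorEmbLoc_eq_smul_leviOpPi)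
open Summit.HodgeConjecture.HodgeConjecture.Cruxes.HLiu418.K2LiuLocalSWCornerImplementerLetters (exists_hB_tensorEmbLoc)

namespace Summit.HodgeConjecture.HodgeConjecture.Cruxes.HLiu418.K2LiuConeGraphReadingOperator

/-! ## §0 Siegel-Levi products; the Levi letter read on vectors (B2-read) -/

/-- four-term conjugation bookkeeping: if `J ∘ Fr⁻¹ = Fr⁻¹ ∘ Γ` then `Fr ∘ J⁻¹ = Γ⁻¹ ∘ Fr`. [folklore] -/
theorem apply_symm_eq_symm_apply_of_conj {R V : Type*} [Semiring R] [AddCommMonoid V] [Module R V] (J Γ Fr : V ≃ₗ[R] V)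
    (h : ∀ X, J (Fr.symm X) = Fr.symm (Γ X)) (Ψ : V) : Fr (J.symm Ψ) = Γ.symm (Fr Ψ) := by
  have h1 := h (Γ.symm (Fr Ψ))
  rw [LinearEquiv.apply_symm_apply, LinearEquiv.symm_apply_apply] at h1
  have h2 : Fr.symm (Γ.symm (Fr Ψ)) = J.symm Ψ := J.injective (by rw [LinearEquiv.apply_symm_apply]; exact h1)
  rw [← h2, LinearEquiv.apply_symm_apply]

section Generic

variable (F : Type) [Field F] [NumberField F] (E : Type) [Field E] [NumberField E] [Algebra F E] (c : E ≃ₐ[F] E)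
  (v : HeightOneSpectrum (𝓞 F)) (n : ℕ) {JD : Matrix (Fin (n + n)) (Fin (n + n)) E}

/-- **products of Siegel-LEVI elements are Siegel-Levi, with multiplicative `A`- and `D`-blocks** (`adapt` is multiplicative, ★ `adapt_mul`). [cite: Kudla1994, §3] -/
theorem levi_mul_blocks {p q : UnitaryGroup.localPi E c (n + n) JD v}
    (hBp : blkB (matA F E c v n p) = 0) (hCp : blkC (matA F E c v n p) = 0) (hBq : blkB (matA F E c v n q) = 0) (hCq : blkC (matA F E c v n q) = 0) :
    blkA (matA F E c v n (p * q)) = blkA (matA F E c v n p) * blkA (matA F E c v n q) ∧ blkB (matA F E c v n (p * q)) = 0 ∧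
      blkC (matA F E c v n (p * q)) = 0 ∧ blkD (matA F E c v n (p * q)) = blkD (matA F E c v n p) * blkD (matA F E c v n q) := by
  have h : adapt (matA F E c v n (p * q)) =
      Matrix.fromBlocks (blkA (matA F E c v n p) * blkA (matA F E c v n q)) 0 0 (blkD (matA F E c v n p) * blkD (matA F E c v n q)) := by
    rw [← matA_mul, adapt_mul, adapt_eq (matA F E c v n p), adapt_eq (matA F E c v n q), hBp, hCp, hBq, hCq, Matrix.fromBlocks_multiply]
    simp
  rw [adapt_eq] at h
  obtain ⟨hA, hB, hC, hD⟩ := Matrix.fromBlocks_inj.1 h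
  exact ⟨hA, hB, hC, hD⟩

variable {N : ℕ} {T : Matrix (Fin N) (Fin N) F}

/-- **(B2-read) THE LEVI LETTER READ ON VECTORS**: if `g = transportSp 𝕋 (m(B))` in `Sp(𝕎_v)` then `B x = (g (x, 0)).1` and `(g (x, 0)).2 = 0`
(`transportSp 𝕋 (m(B)) (x, y) = (B x, 𝕋⁻¹ B⁻ᵀ 𝕋 y)`, ★ `transportSp_levi`). [cite: Weil1964, n° 6, p. 151] [cite: MoeglinVignerasWaldspurger1987, Chap. 2 II.2] -/
theorem mulVec_eq_fst_apply_of_eq_transportSp_levi (hT : IsUnit (localGram F N T v).det) (g : LocalSp F N T v)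
    (B : GL (Fin N) (v.adicCompletion F)) (h : g = transportSp (localGram F N T v) hT (levi B)) (x : Fin N → v.adicCompletion F) :
    (B : Matrix (Fin N) (Fin N) (v.adicCompletion F)) *ᵥ x =
        ((g : ((Fin N → v.adicCompletion F) × (Fin N → v.adicCompletion F)) ≃ₗ[v.adicCompletion F]
          ((Fin N → v.adicCompletion F) × (Fin N → v.adicCompletion F))) (x, 0)).1 ∧
      ((g : ((Fin N → v.adicCompletion F) × (Fin N → v.adicCompletion F)) ≃ₗ[v.adicCompletion F]
          ((Fin N → v.adicCompletion F) × (Fin N → v.adicCompletion F))) (x, 0)).2 = 0 := by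
  subst h
  rw [transportSp_levi, coe_leviSp_apply, glEquiv_apply, map_zero]
  exact ⟨rfl, rfl⟩

/-- **(B2-read) the inverse letter**: `B⁻¹ x = (g⁻¹ (x, 0)).1` (`g⁻¹ = transportSp 𝕋 (m(B⁻¹))`). [cite: Weil1964, n° 6, p. 151] -/
theorem inv_mulVec_eq_fst_apply_of_eq_transportSp_levi (hT : IsUnit (localGram F N T v).det) (g : LocalSp F N T v)
    (B : GL (Fin N) (v.adicCompletion F)) (h : g = transportSp (localGram F N T v) hT (levi B)) (x : Fin N → v.adicCompletion F) :
    ((B⁻¹ : GL (Fin N) (v.adicCompletion F)) : Matrix (Fin N) (Fin N) (v.adicCompletion F)) *ᵥ x =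
        (((g⁻¹ : LocalSp F N T v) : ((Fin N → v.adicCompletion F) × (Fin N → v.adicCompletion F)) ≃ₗ[v.adicCompletion F]
          ((Fin N → v.adicCompletion F) × (Fin N → v.adicCompletion F))) (x, 0)).1 ∧
      (glEquiv B).symm x =
        (((g⁻¹ : LocalSp F N T v) : ((Fin N → v.adicCompletion F) × (Fin N → v.adicCompletion F)) ≃ₗ[v.adicCompletion F]
          ((Fin N → v.adicCompletion F) × (Fin N → v.adicCompletion F))) (x, 0)).1 := by
  have hinv : g⁻¹ = transportSp (localGram F N T v) hT (levi B⁻¹) := by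
    rw [h, ← map_inv, show (levi B⁻¹ : Matrix.symplecticGroup (Fin N) (v.adicCompletion F)) = (levi B)⁻¹ from map_inv leviHom B]
  exact ⟨(mulVec_eq_fst_apply_of_eq_transportSp_levi F v hT g⁻¹ B⁻¹ hinv x).1,
    (glEquiv_symm_apply B x).trans (mulVec_eq_fst_apply_of_eq_transportSp_levi F v hT g⁻¹ B⁻¹ hinv x).1⟩

end Generic

/-! ## §1 The operator layer: `op(j̃) ∘ frameOp⁻¹ ∘ ω(s′(p₀ ⊗ 1)) ∘ frameOp ∘ op(j̃)⁻¹ = c · r(m(B))` read through the frame -/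

section Tensor

variable (L : Type) [Field L] [NumberField L] [IsCMField L]
variable {N M : ℕ} (e : Fin N × Fin M ≃ Fin 2)
  (dV : Fin N → L) (hdV : ∀ i, IsCMField.complexConj L (dV i) = dV i)
  (dW : Fin M → L) (hdW : ∀ i, IsCMField.complexConj L (dW i) = dW i)
variable {M₂ M' : ℕ} (eW : Fin M × Fin M₂ ≃ Fin M') (e' : Fin N × Fin M' ≃ Fin (M₂ + M₂))
  (dV' : Fin M₂ → L) (hdV' : ∀ k, IsCMField.complexConj L (dV' k) = dV' k)
  (v : HeightOneSpectrum (𝓞 (Fp L)))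
  [MeasurableSpace (v.adicCompletion (Fp L))] [BorelSpace (v.adicCompletion (Fp L))]
  (μ : Measure (v.adicCompletion (Fp L))) [μ.IsAddHaarMeasure]
  (χ : HeckeCharacter L) (hχ : IsSplittingChar L 1 χ)

variable {σ : Equiv.Perm (Fin (M₂ + M₂))} {T₁ T₂ : Matrix (Fin M₂) (Fin M₂) (Fp L)}
  (P : GL (Fin (M₂ + M₂)) (Fp L)) (hPσ : (P : Matrix (Fin (M₂ + M₂)) (Fin (M₂ + M₂)) (Fp L)) = σ.toPEquiv.toMatrix)
  (hP : ((P : Matrix (Fin (M₂ + M₂)) (Fin (M₂ + M₂)) (Fp L)))ᵀ *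
      gramR L e' dV hdV (tensorFrame L dW eW dV') (tensorFrame_real L dW hdW eW dV' hdV') * (P : Matrix _ _ (Fp L)) =
    UnitaryGroup.finSum M₂ M₂ T₁ T₂)
  {PD : GL (Fin ((M₂ + M₂) + (M₂ + M₂))) (Fp L)} (hPD : PD = UnitaryGroup.reindexGL (e₂ (M₂ + M₂)) (UnitaryGroup.blockDiagGL (P, P)))
  (hT₁ : T₁.IsSymm) (hT₂ : T₂.IsSymm)
  (hT₀d : IsUnit (gramR L e' dV hdV (tensorFrame L dW eW dV') (tensorFrame_real L dW hdW eW dV' hdV')).det)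
  (hTv' : IsUnit (localGram (Fp L) ((M₂ + M₂) + (M₂ + M₂)) (gramD (Fp L) (M₂ + M₂) (UnitaryGroup.finSum M₂ M₂ T₁ T₂)) v).det)
  (hTv₁ : IsUnit (localGram (Fp L) (M₂ + M₂) (gramD (Fp L) M₂ T₁) v).det)
  (hTv₂ : IsUnit (localGram (Fp L) (M₂ + M₂) (gramD (Fp L) M₂ T₂) v).det)
  -- Cayley-type block movers (★ GR91 `exists_mover_conj_iotaD_weylDelta` + ★ `MpPsi.proj_surjective`; the EXPLICIT pair in (B2-coord))
  (p₁ : LocalMp (Fp L) (M₂ + M₂) (gramD (Fp L) M₂ T₁) v)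
  (hp₁ : (deltaLagrangian (Fp L) v M₂).map (toLin (Fp L) v (MpPsi.proj _ p₁)) = lagrangianY (Fp L) (M₂ + M₂) v)
  (B₁ : GL (Fin (M₂ + M₂)) (v.adicCompletion (Fp L)))
  (hW₁ : MpPsi.proj _ p₁ * iotaD (Fp L) L (IsCMField.complexConj L) (complexConj_imagUnit L) (imagUnit_ne_zero L)
      (imagUnit_mul_self L) v M₂ hT₁ rfl (weylDelta (Fp L) L (IsCMField.complexConj L) v M₂ (T₀ := T₁) rfl) * (MpPsi.proj _ p₁)⁻¹ =
    (transportSp (localGram (Fp L) (M₂ + M₂) (gramD (Fp L) M₂ T₁) v) hTv₁ (SymplecticGroup.symJ _ _))⁻¹ *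
      transportSp (localGram (Fp L) (M₂ + M₂) (gramD (Fp L) M₂ T₁) v) hTv₁ (levi B₁))
  (p₂ : LocalMp (Fp L) (M₂ + M₂) (gramD (Fp L) M₂ T₂) v)
  (hp₂ : (deltaLagrangian (Fp L) v M₂).map (toLin (Fp L) v (MpPsi.proj _ p₂)) = lagrangianY (Fp L) (M₂ + M₂) v)
  (B₂ : GL (Fin (M₂ + M₂)) (v.adicCompletion (Fp L)))
  (hW₂ : MpPsi.proj _ p₂ * iotaD (Fp L) L (IsCMField.complexConj L) (complexConj_imagUnit L) (imagUnit_ne_zero L)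
      (imagUnit_mul_self L) v M₂ hT₂ rfl (weylDelta (Fp L) L (IsCMField.complexConj L) v M₂ (T₀ := T₂) rfl) * (MpPsi.proj _ p₂)⁻¹ =
    (transportSp (localGram (Fp L) (M₂ + M₂) (gramD (Fp L) M₂ T₂) v) hTv₂ (SymplecticGroup.symJ _ _))⁻¹ *
      transportSp (localGram (Fp L) (M₂ + M₂) (gramD (Fp L) M₂ T₂) v) hTv₂ (levi B₂))

set_option maxHeartbeats 4000000 in -- as ★ (C2b′)∕(M2a-C2a): `congrArg`∕`Eq.trans` chains on the doubled `LocalMp` letters (no `rw` on them)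
include hPσ hT₁ hT₂ hTv' hTv₁ hTv₂ hW₁ hW₂ hp₁ hp₂ in
/-- **(B1) THE GRAPH READING, OPERATOR LAYER.**  For every small Siegel-LEVI `p₀` (`B(p₀) = 0 = C(p₀)`) there is a Levi letter `B` — ★ [A1-ζ]'s `hB` bytes at
the implementer of record `m := frameMp_{PD} j̃(p₁, p₂)` (★ p864771) — such that for every `Ψ ∈ 𝒮(L⁺_v^{n′})` and every `u`:
`(op(j̃)(frameOp_{PD}⁻¹(ω(s′(p₀ ⊗ 1))((frameOp_{PD})(op(j̃)⁻¹ Ψ)))))(u) = (χ_v⁻¹(det_Δ p₀)^{M₂})⁻¹ · |det B|^{-1/2} · Ψ(P̂D⁻¹ (B⁻¹ (P̂D u)))` —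
`op(j̃) ∘ frameOp⁻¹ = frameOp⁻¹ ∘ op(m)` (★ (C2b′)), Kudla's Levi action through `m` (★ [A1-ζ] ∕ ★ (C3-a)), then the formulas of `frameOp` and `r(m(B))`.
[cite: Kudla1994, §3 Thm. 3.1] [cite: Rangarao1993, Lemma 3.2 (3.8), p. 351] [cite: MoeglinVignerasWaldspurger1987, Chap. 2 I.7, II.1 Rem. (3), (6), II.6] -/
theorem exists_levi_letter_toOp_boxLoc_localSplitting_tensorEmbLoc_apply
    (p₀ : UnitaryGroup.localPi L (IsCMField.complexConj L) (2 + 2) (hermD L e dV hdV dW hdW) v)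
    (hB0 : blkB (matA (Fp L) L (IsCMField.complexConj L) v 2 p₀) = 0) (hC0 : blkC (matA (Fp L) L (IsCMField.complexConj L) v 2 p₀) = 0) :
    ∃ B : GL (Fin ((M₂ + M₂) + (M₂ + M₂))) (v.adicCompletion (Fp L)),
      MpPsi.proj _ (frameMp (Fp L) v ((M₂ + M₂) + (M₂ + M₂)) PD (transpose_pd_mul_gramD_mul_pd (Fp L) (M₂ + M₂) P hP hPD)
          (boxLoc (Fp L) v M₂ M₂ (T₁ := T₁) (T₂ := T₂) (p₁, p₂))) *
        iotaD (Fp L) L (IsCMField.complexConj L) (complexConj_imagUnit L) (imagUnit_ne_zero L) (imagUnit_mul_self L) v (M₂ + M₂)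
          (gramR_isSymm L e' dV hdV (tensorFrame L dW eW dV') (tensorFrame_real L dW hdW eW dV' hdV'))
          (hermD_eq_map_gramD L e' dV hdV (tensorFrame L dW eW dV') (tensorFrame_real L dW hdW eW dV' hdV'))
          (tensorEmbLoc L e dV hdV dW hdW eW e' dV' hdV' v p₀) *
        (MpPsi.proj _ (frameMp (Fp L) v ((M₂ + M₂) + (M₂ + M₂)) PD (transpose_pd_mul_gramD_mul_pd (Fp L) (M₂ + M₂) P hP hPD)
          (boxLoc (Fp L) v M₂ M₂ (T₁ := T₁) (T₂ := T₂) (p₁, p₂))))⁻¹ =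
      transportSp (localGram (Fp L) ((M₂ + M₂) + (M₂ + M₂))
          (gramD (Fp L) (M₂ + M₂) (gramR L e' dV hdV (tensorFrame L dW eW dV') (tensorFrame_real L dW hdW eW dV' hdV'))) v)
        (isUnit_det_localGram_gramD (Fp L) v (M₂ + M₂) hT₀d) (levi B) ∧
      ∀ (Ψ : SchwartzBruhat (Fin ((M₂ + M₂) + (M₂ + M₂)) → v.adicCompletion (Fp L))) (u : Fin ((M₂ + M₂) + (M₂ + M₂)) → v.adicCompletion (Fp L)),
        ((MpPsi.toOp _ (boxLoc (Fp L) v M₂ M₂ (T₁ := T₁) (T₂ := T₂) (p₁, p₂))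
            ((frameOp (Fp L) v ((M₂ + M₂) + (M₂ + M₂)) PD).symm
              (MpPsi.toRep (localSchrodinger (Fp L) ((M₂ + M₂) + (M₂ + M₂))
                  (gramD (Fp L) (M₂ + M₂) (gramR L e' dV hdV (tensorFrame L dW eW dV') (tensorFrame_real L dW hdW eW dV' hdV'))) v)
                ((localSplittingDatumCM L v μ (M₂ + M₂)
                  (gramR_isSymm L e' dV hdV (tensorFrame L dW eW dV') (tensorFrame_real L dW hdW eW dV' hdV')) hT₀d
                  (hermD_eq_map_gramD L e' dV hdV (tensorFrame L dW eW dV') (tensorFrame_real L dW hdW eW dV' hdV')) χ hχ).localSplitting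
                  (tensorEmbLoc L e dV hdV dW hdW eW e' dV' hdV' v p₀))
                ((frameOp (Fp L) v ((M₂ + M₂) + (M₂ + M₂)) PD)
                  ((MpPsi.toOp _ (boxLoc (Fp L) v M₂ M₂ (T₁ := T₁) (T₂ := T₂) (p₁, p₂))).symm Ψ)))) :
            SchwartzBruhat (Fin ((M₂ + M₂) + (M₂ + M₂)) → v.adicCompletion (Fp L))) :
          (Fin ((M₂ + M₂) + (M₂ + M₂)) → v.adicCompletion (Fp L)) → ℂ) u =
        (((LocalSplitting.chiDet (Fp L) L (IsCMField.complexConj L) v 2 (fun w' : PlacesOver L v => (χ.localComponent w'.1)⁻¹) p₀ ^ M₂)⁻¹ : ℂˣ) : ℂ) *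
          (((modSqrt (glEquiv B) : ℝ) : ℂ)⁻¹ *
            (Ψ : (Fin ((M₂ + M₂) + (M₂ + M₂)) → v.adicCompletion (Fp L)) → ℂ)
              ((frameLin (Fp L) v ((M₂ + M₂) + (M₂ + M₂)) PD).symm
                ((glEquiv B).symm (frameLin (Fp L) v ((M₂ + M₂) + (M₂ + M₂)) PD u)))) := by
  haveI : Algebra.IsQuadraticExtension (Fp L) L := IsCMField.isQuadraticExtension L
  obtain ⟨B, hB⟩ := exists_hB_tensorEmbLoc L e dV hdV dW hdW eW e' dV' hdV' v P hPσ hP hPD hT₁ hT₂ hT₀d hTv' hTv₁ hTv₂ p₁ hp₁ B₁ hW₁ p₂ hp₂ B₂ hW₂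
    p₀ hB0 hC0
  refine ⟨B, hB, fun Ψ u => ?_⟩
  have hp₀ : IsSiegelDelta (Fp L) L (IsCMField.complexConj L) (complexConj_imagUnit L) (imagUnit_ne_zero L) (imagUnit_mul_self L) v 2
      (gramR_isSymm L e dV hdV dW hdW) (hermD_eq_map_gramD L e dV hdV dW hdW) p₀ :=
    (isSiegelDelta_iff_blkC_eq_zero (Fp L) L (IsCMField.complexConj L) (complexConj_imagUnit L) (imagUnit_ne_zero L) (imagUnit_mul_self L) v 2
      (gramR_isSymm L e dV hdV dW hdW) (hermD_eq_map_gramD L e dV hdV dW hdW) p₀).2 hC0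
  -- `frameOp (op(j̃)⁻¹ Ψ) = op(m)⁻¹ (frameOp Ψ)` from ★ (C2b′) `op(j̃) ∘ frameOp⁻¹ = frameOp⁻¹ ∘ op(m)`
  have h1 := apply_symm_eq_symm_apply_of_conj (MpPsi.toOp _ (boxLoc (Fp L) v M₂ M₂ (T₁ := T₁) (T₂ := T₂) (p₁, p₂)))
    (MpPsi.toOp _ (frameMp (Fp L) v ((M₂ + M₂) + (M₂ + M₂)) PD (transpose_pd_mul_gramD_mul_pd (Fp L) (M₂ + M₂) P hP hPD)
      (boxLoc (Fp L) v M₂ M₂ (T₁ := T₁) (T₂ := T₂) (p₁, p₂))))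
    (frameOp (Fp L) v ((M₂ + M₂) + (M₂ + M₂)) PD) (fun X => toOp_boxLoc_frameOp_symm L dV hdV dW hdW eW e' dV' hdV' v P hP hPD p₁ p₂ X) Ψ
  -- the section's `toRep ∘ localSplitting` IS `localOmega` (definitionally)
  have hΩ : ∀ Φ : SchwartzBruhat (Fin ((M₂ + M₂) + (M₂ + M₂)) → v.adicCompletion (Fp L)),
      MpPsi.toRep (localSchrodinger (Fp L) ((M₂ + M₂) + (M₂ + M₂))
          (gramD (Fp L) (M₂ + M₂) (gramR L e' dV hdV (tensorFrame L dW eW dV') (tensorFrame_real L dW hdW eW dV' hdV'))) v)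
        ((localSplittingDatumCM L v μ (M₂ + M₂)
          (gramR_isSymm L e' dV hdV (tensorFrame L dW eW dV') (tensorFrame_real L dW hdW eW dV' hdV')) hT₀d
          (hermD_eq_map_gramD L e' dV hdV (tensorFrame L dW eW dV') (tensorFrame_real L dW hdW eW dV' hdV')) χ hχ).localSplitting
          (tensorEmbLoc L e dV hdV dW hdW eW e' dV' hdV' v p₀)) Φ =
      (localSplittingDatumCM L v μ (M₂ + M₂)
          (gramR_isSymm L e' dV hdV (tensorFrame L dW eW dV') (tensorFrame_real L dW hdW eW dV' hdV')) hT₀d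
          (hermD_eq_map_gramD L e' dV hdV (tensorFrame L dW eW dV') (tensorFrame_real L dW hdW eW dV' hdV')) χ hχ).localOmega
        (tensorEmbLoc L e dV hdV dW hdW eW e' dV' hdV' v p₀) Φ := fun _ => rfl
  -- Kudla's Levi word through `m` (★ [A1-ζ] at `m := frameMp PD j̃`, `hB` from ★ p864771)
  have hLevi := toOp_localOmega_tensorEmbLoc_eq_smul_leviOpPi L e dV hdV dW hdW eW e' dV' hdV' v μ χ hχ hT₀d p₀ hp₀
    (frameMp (Fp L) v ((M₂ + M₂) + (M₂ + M₂)) PD (transpose_pd_mul_gramD_mul_pd (Fp L) (M₂ + M₂) P hP hPD)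
      (boxLoc (Fp L) v M₂ M₂ (T₁ := T₁) (T₂ := T₂) (p₁, p₂))) B hB (frameOp (Fp L) v ((M₂ + M₂) + (M₂ + M₂)) PD Ψ)
  rw [h1, hΩ, toOp_boxLoc_frameOp_symm L dV hdV dW hdW eW e' dV' hdV' v P hP hPD p₁ p₂, hLevi, coe_frameOp_symm_apply, Units.smul_def,
    Submodule.coe_smul, Pi.smul_apply, smul_eq_mul, coe_leviOpPi_apply, coe_frameOp_apply]

end Tensor

end Summit.HodgeConjecture.HodgeConjecture.Cruxes.HLiu418.K2LiuConeGraphReadingOperator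

end
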